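import Summits.BirchSwinnertonDyer.Rank1Residual.AdditivePotMult.QuadraticBaseChangeDescentOverC
import Summits.BirchSwinnertonDyer.Rank1Residual.AdditivePotMult.TwistSupplyOddDiscr
import HarnessLib

/-!
# X4(M), ALL PAIRS, WITHOUT MILNE: additive-p1's uniform class theorems `bsdp_of_classX4M_of_ram`,
# `bsdp_of_classX4M`, `missingPPartAt_of_classX4M[_of_ram]` re-issued with `{hMilneC} ↦ ∅`
# (row T-MIL-UNI, FILE U-4; seat n1011-p01 GEN 10)

HONEST FRAMING (cell `b2b-bsdres`, run/shared/lean/b2b/bsd-rank1-residual/, verbatim in every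
file): the goal of the cell is to DELETE the COMBINATION-SHAPED residual classes of the
Birch–Swinnerton-Dyer formula for ALL analytic-rank `≤ 1` elliptic curves over `ℚ` — "full BSD
formula for every rank `≤ 1` curve in class `C`" assembled STRICTLY from published theorems — so
that the rank-`≤ 1` remainder becomes exactly the CONSTRUCTION-SHAPED classes, which are TYPED
(missing-input `Prop`s), NOT attempted. This is not "finishing BSD". Sub-classes X3♯(M) / X4(M)
(additive, potentially multiplicative prime; base-change-and-descend): a RESEARCH ROUTE; they stay
CONSTRUCTION-SHAPED; nothing is booked by this file; no mark / label moved. THEOREMS ONLY: no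
definition, no named fact, no `sorry`.

## What (row T-MIL-UNI, `cells/n1011/skel/T-MIL-UNI.md` §0 (e), FILE U-4)

additive-p1's ALL-PAIRS relocation of X4(M) (`TwistSupplyRam.bsdp_of_classX4M_of_ram`,
`TwistSupplyX4.bsdp_of_classX4M`, `…missingPPartAt_of_classX4M[_of_ram]`) carries Milne's
Weil-restriction identity as the NAMED FACT `hMilneC : Milne1972.bsdQuotient_baseChange_quadratic_anyModel`
(A73; flag MIL72-primary-unread). This file re-issues the four theorems with binder diff EXACTLY
`{hMilneC} ↦ ∅` — every other binder and the conclusion byte-identical —: the rank-zero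
`p`-multiplicative twist is taken over a quadratic field with ODD discriminant prime to the other
additive primes (FILE U-3 `ClassX4M.exists_rankZero_mult_twist_oddDiscr`: Hoffstein–Luo 1997 + the
twist root number, the SAME named-fact binders `hnf`, `hHL` as additive-p1's supply), on which the
T-MIL odd-Tamagawa / `Ш` / torsion / regulator / period identities make Milne's identity a THEOREM in
the `ord_p` currency of the descent, transported to Dokchitser–Dokchitser's model-free
`MissingPPartOverCAt (W.baseChange K) p` by the θ-model (FILES U-1a/U-1b/U-2).

* **`bsdp_of_classX4M_of_ram_noMilne`** — X4(M) ∧ (ram), `r_an(E) ≤ 1`: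
  `BSD(E,p) ⇐ [∀ K quadratic, W_d ⊨ E^{(d_K)} globally minimal with Mult W_d p :
  MissingPPartOverCAt (W.baseChange K) p]`, inputs Skinner 2016 Thm. C (`hSk`), GZK, modularity
  (`hmod`, `hnf`), Hoffstein–Luo 1997 (`hHL`) — NO Milne;
* **`bsdp_of_classX4M_noMilne`** — ALL X4(M) pairs, `r_an(E) ≤ 1`: the same plus x11a's typed
  rank-zero input `X11RankZero.MissingInputAt` for the produced twist when it fails (ram) (Wuthrich
  2014 Prop. 21 `hW`), exactly as in `bsdp_of_classX4M` — NO Milne;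
* `bsdp_of_classX4M_of_ram_of_forall_quadratic_noMilne`, `missingPPartAt_of_classX4M_of_ram_noMilne`,
  `missingPPartAt_of_classX4M_noMilne` — the plainer-hypothesis / `MissingPPartAt` currencies.

So on the WHOLE class X4(M) (analytic rank `≤ 1`) the base-change-and-descend relocation now rests
on {GZK, modularity, Hoffstein–Luo 1997, Skinner 2016 Thm. C [(ram) rows] / x11a's typed input
[non-(ram) rows]} and the ONE typed over-`K` input — Milne 1972 / A73 is no longer an input of the
X4(M) relocation. HONEST LIMITS: X4(M) stays CONSTRUCTION-SHAPED (`MissingPPartOverCAt` untouched, and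
`X11RankZero.MissingInputAt` on the non-(ram) rows); analytic rank `≥ 2` not covered; the X3♯(M) twin
(`TwistSupply.bsdp_of_classX3M`, Greenberg–Vatsal binders) is NOT re-issued here; closes no class;
moves no mark; 0 facts.

References: J. S. Milne, Invent. Math. 17 (1972) §1 Thm. 1 [Milne1972ArithmeticAV] (the fact
REMOVED); C. Skinner, Pacific J. Math. 283 (2016) Thm. C [Skinner2016PacificMC]; J. Hoffstein, W. Luo,
Math. Res. Lett. 4 (1997) [HoffsteinLuo1997]; C. Wuthrich, Doc. Math. 19 (2014) Prop. 21 [Wuthrich2014];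
T. Dokchitser, V. Dokchitser, Ann. of Math. 172 (2010) §1, §2.1 [DokchitserDokchitserAnnals2010].
-/

noncomputable section

open scoped Classical

open WeierstrassCurve Literature.NumberTheory.EllipticCurves
  Literature.NumberTheory.EllipticCurves.ModularForms
  Literature.NumberTheory.EllipticCurves.Rank1Residual
  Literature.NumberTheory.EllipticCurves.Rank1Residual.Typed
  Literature.NumberTheory.EllipticCurves.Wuthrich2014
  IsDedekindDomain

namespace Summit.BirchSwinnertonDyer.Rank1Residual.AdditivePotMult

section NoMilne

variable {W : WeierstrassCurve ℚ} [W.IsElliptic] {p : ℕ} [Fact p.Prime]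

/-- **X4(M) ∧ (ram) ⇐ the over-`K` input over quadratic fields, WITHOUT MILNE.** Let `(E,p) ∈ X4(M)`
(`W` globally minimal) have analytic rank `≤ 1` and satisfy (ram). Suppose the typed over-`K` input
`MissingPPartOverCAt (W.baseChange K) p` holds for every quadratic field `K` whose twist `E^{(d_K)}`
(globally minimal model `W_d`) is multiplicative at `p`. Then `BSD(E,p)` — Skinner 2016 Thm. C
(`hSk`), GZK (`hGZK`), modularity (`hmod`, `hnf`) and Hoffstein–Luo 1997 (`hHL`) being the published
inputs carried as binders; additive-p1's `TwistSupplyRam.bsdp_of_classX4M_of_ram` with the binder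
`hMilneC` (Milne 1972, A73) REMOVED. Proof: the odd-discriminant twist of FILE U-3 (Irr, Ram
transported, `r_an = 0`, H-4b's population) and FILE U-2's model-free rank-zero-twist END.
[cite: Skinner2016PacificMC, Thm. C (§1), footnote 1, §2.5]
[cite: HoffsteinLuo1997, Theorem (§1, pp. 435–436)]
[cite: Milne1972ArithmeticAV, §1 Thm. 1 and §2 (through DokchitserDokchitserAnnals2010, §2.1, proof of Thm. 8)] -/
theorem bsdp_of_classX4M_of_ram_noMilne [W.IsGloballyMinimal]
    (hGZK : rank_eq_analyticRank_of_analyticRank_le_one) (hmod : hasEntireLFunction_rat)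
    (hSk : Skinner2016.thmC_padicValRat_bsd_rank_zero)
    (hnf : exists_isNewformOf) (hHL : HoffsteinLuo1997_exists_twist_L_one_ne_zero)
    (hX : ClassX4M W p) (hr : W.analyticRank ≤ 1) (hram : Ram W p)
    (hK : ∀ (K : Type) [Field K] [NumberField K] (Wd : WeierstrassCurve ℚ) [Wd.IsElliptic]
      [Wd.IsGloballyMinimal], Module.finrank ℚ K = 2 →
      (∃ C : VariableChange ℚ, C • W.quadraticTwist (NumberField.discr K : ℚ) = Wd) →
      Mult Wd p → MissingPPartOverCAt (W.baseChange K) p) :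
    BSDp W p := by
  obtain ⟨K, iF, iN, Wd, iWd, iWdm, Cd, h2, hodd, hsq, hpd, hWd, hmult, -, hr0, hS, hramT⟩ :=
    hX.exists_rankZero_mult_twist_oddDiscr hnf hHL
  exact bsdp_of_classX4M_of_rankZero_twist_noMilne_overC_of_addv_unramified_oddPrime_of_dvd_discr W p
    K Wd hGZK hmod hSk hX hr h2 hodd hsq hpd hWd hmult (hramT hram) hr0 hS (hK K Wd h2 ⟨Cd, hWd⟩ hmult)

/-- **X4(M), ALL pairs, WITHOUT MILNE: `BSD(E,p)` ⇐ over-`K` input over quadratic fields + the typed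
rank-zero X11 input for the `p`-multiplicative curves.** Let `(E,p) ∈ X4(M)` (`W` globally minimal)
have analytic rank `≤ 1`. Assume (i) `MissingPPartOverCAt (W.baseChange K) p` for every quadratic
field `K` whose twist `E^{(d_K)}` is multiplicative at `p`, and (ii) the cell's typed input
`X11RankZero.MissingInputAt V p` for every globally minimal `V/ℚ` of analytic rank `0` in class X11 at
`p` (x11a's CONSTRUCTION-SHAPED input — needed only when the produced twist fails (ram)). Then
`BSD(E,p)`: additive-p1's `TwistSupplyX4.bsdp_of_classX4M` with the binder `hMilneC` (Milne 1972,
A73) REMOVED, everything else identical — the odd-discriminant twist `W_d` of FILE U-3 is closed by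
Skinner 2016 Thm. C (`hSk`) if `Ram Wd p`, by (ii) with Wuthrich 2014 Prop. 21 (`hW`) otherwise
(`X11RankZero.bsdp_of_missingInputAt`), and FILE U-2's model-free Milne-free END descends.
X4(M) stays CONSTRUCTION-SHAPED. [cite: Skinner2016PacificMC, Thm. C (§1), footnote 1, §2.5]
[cite: Wuthrich2014, Prop. 21] [cite: HoffsteinLuo1997, Theorem (§1, pp. 435–436)]
[cite: Milne1972ArithmeticAV, §1 Thm. 1 and §2 (through DokchitserDokchitserAnnals2010, §2.1, proof of Thm. 8)] -/
theorem bsdp_of_classX4M_noMilne [W.IsGloballyMinimal]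
    (hGZK : rank_eq_analyticRank_of_analyticRank_le_one) (hmod : hasEntireLFunction_rat)
    (hSk : Skinner2016.thmC_padicValRat_bsd_rank_zero) (hW : sha_dvd_analyticSha)
    (hnf : exists_isNewformOf) (hHL : HoffsteinLuo1997_exists_twist_L_one_ne_zero)
    (hX : ClassX4M W p) (hr : W.analyticRank ≤ 1)
    (hK : ∀ (K : Type) [Field K] [NumberField K] (Wd : WeierstrassCurve ℚ) [Wd.IsElliptic]
      [Wd.IsGloballyMinimal], Module.finrank ℚ K = 2 →
      (∃ C : VariableChange ℚ, C • W.quadraticTwist (NumberField.discr K : ℚ) = Wd) →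
      Mult Wd p → MissingPPartOverCAt (W.baseChange K) p)
    (hX11 : ∀ (V : WeierstrassCurve ℚ) [V.IsElliptic] [V.IsGloballyMinimal],
      V.analyticRank = 0 → ClassX11 V p → X11RankZero.MissingInputAt V p) :
    BSDp W p := by
  have hp2 : p ≠ 2 := hX.p_ne_two
  obtain ⟨K, iF, iN, Wd, iWd, iWdm, Cd, h2, hodd, hsq, hpd, hWd, hmult, hirr, hr0, hS, -⟩ :=
    hX.exists_rankZero_mult_twist_oddDiscr hnf hHL
  by_cases hram : Ram Wd p
  · exact bsdp_of_classX4M_of_rankZero_twist_noMilne_overC_of_addv_unramified_oddPrime_of_dvd_discr W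
      p K Wd hGZK hmod hSk hX hr h2 hodd hsq hpd hWd hmult hram hr0 hS (hK K Wd h2 ⟨Cd, hWd⟩ hmult)
  · have hX11d : ClassX11 Wd p := ⟨hmult, hirr, Or.inl hram⟩
    have hd : BSDp Wd p :=
      X11RankZero.bsdp_of_missingInputAt hW hGZK hmod Wd p hp2 hr0 hX11d (hX11 Wd hr0 hX11d)
    exact bsdp_of_pPartOverC_baseChange_of_bsdp_twist_noMilne_of_addv_unramified_oddPrime_of_dvd_discr W
      p K Wd hGZK hmod h2 hodd hsq hpd hWd hr (by rw [hr0]; exact zero_le_one) hp2 hmult hS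
      (hK K Wd h2 ⟨Cd, hWd⟩ hmult) hd

/-- **X4(M) ∧ (ram) with the plainer hypothesis** "the `p`-part of BSD for `E` over every quadratic
field", WITHOUT MILNE (additive-p1's `bsdp_of_classX4M_of_ram_of_forall_quadratic` minus `hMilneC`).
[cite: Skinner2016PacificMC, Thm. C (§1), footnote 1, §2.5]
[cite: Milne1972ArithmeticAV, §1 Thm. 1 and §2 (through DokchitserDokchitserAnnals2010, §2.1, proof of Thm. 8)] -/
theorem bsdp_of_classX4M_of_ram_of_forall_quadratic_noMilne [W.IsGloballyMinimal]
    (hGZK : rank_eq_analyticRank_of_analyticRank_le_one) (hmod : hasEntireLFunction_rat)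
    (hSk : Skinner2016.thmC_padicValRat_bsd_rank_zero)
    (hnf : exists_isNewformOf) (hHL : HoffsteinLuo1997_exists_twist_L_one_ne_zero)
    (hX : ClassX4M W p) (hr : W.analyticRank ≤ 1) (hram : Ram W p)
    (hK : ∀ (K : Type) [Field K] [NumberField K], Module.finrank ℚ K = 2 →
      MissingPPartOverCAt (W.baseChange K) p) :
    BSDp W p :=
  bsdp_of_classX4M_of_ram_noMilne hGZK hmod hSk hnf hHL hX hr hram fun K _ _ _ _ _ h2 _ _ ↦ hK K h2

/-- The X4(M) ∧ (ram) theorem WITHOUT MILNE in the cell's `MissingPPartAt` currency (Partition /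
additive-p4's `X4Sharp` bookkeeping; additive-p1's `missingPPartAt_of_classX4M_of_ram` minus
`hMilneC`). [cite: Skinner2016PacificMC, Thm. C (§1), footnote 1, §2.5]
[cite: Milne1972ArithmeticAV, §1 Thm. 1 and §2 (through DokchitserDokchitserAnnals2010, §2.1, proof of Thm. 8)] -/
theorem missingPPartAt_of_classX4M_of_ram_noMilne [W.IsGloballyMinimal]
    (hGZK : rank_eq_analyticRank_of_analyticRank_le_one) (hmod : hasEntireLFunction_rat)
    (hSk : Skinner2016.thmC_padicValRat_bsd_rank_zero)
    (hnf : exists_isNewformOf) (hHL : HoffsteinLuo1997_exists_twist_L_one_ne_zero)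
    (hX : ClassX4M W p) (hr : W.analyticRank ≤ 1) (hram : Ram W p)
    (hK : ∀ (K : Type) [Field K] [NumberField K] (Wd : WeierstrassCurve ℚ) [Wd.IsElliptic]
      [Wd.IsGloballyMinimal], Module.finrank ℚ K = 2 →
      (∃ C : VariableChange ℚ, C • W.quadraticTwist (NumberField.discr K : ℚ) = Wd) →
      Mult Wd p → MissingPPartOverCAt (W.baseChange K) p) :
    MissingPPartAt W p := by
  haveI : Finite W.sha := (hGZK W hr).2
  exact missingPPartAt_of_bsdp W p (bsdp_of_classX4M_of_ram_noMilne hGZK hmod hSk hnf hHL hX hr hram hK)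

/-- The all-pairs X4(M) relocation WITHOUT MILNE in the cell's `MissingPPartAt` currency
(additive-p1's `missingPPartAt_of_classX4M` minus `hMilneC`). [cite: Skinner2016PacificMC, Thm. C (§1), footnote 1, §2.5]
[cite: Wuthrich2014, Prop. 21]
[cite: Milne1972ArithmeticAV, §1 Thm. 1 and §2 (through DokchitserDokchitserAnnals2010, §2.1, proof of Thm. 8)] -/
theorem missingPPartAt_of_classX4M_noMilne [W.IsGloballyMinimal]
    (hGZK : rank_eq_analyticRank_of_analyticRank_le_one) (hmod : hasEntireLFunction_rat)
    (hSk : Skinner2016.thmC_padicValRat_bsd_rank_zero) (hW : sha_dvd_analyticSha)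
    (hnf : exists_isNewformOf) (hHL : HoffsteinLuo1997_exists_twist_L_one_ne_zero)
    (hX : ClassX4M W p) (hr : W.analyticRank ≤ 1)
    (hK : ∀ (K : Type) [Field K] [NumberField K] (Wd : WeierstrassCurve ℚ) [Wd.IsElliptic]
      [Wd.IsGloballyMinimal], Module.finrank ℚ K = 2 →
      (∃ C : VariableChange ℚ, C • W.quadraticTwist (NumberField.discr K : ℚ) = Wd) →
      Mult Wd p → MissingPPartOverCAt (W.baseChange K) p)
    (hX11 : ∀ (V : WeierstrassCurve ℚ) [V.IsElliptic] [V.IsGloballyMinimal],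
      V.analyticRank = 0 → ClassX11 V p → X11RankZero.MissingInputAt V p) :
    MissingPPartAt W p := by
  haveI : Finite W.sha := (hGZK W hr).2
  exact missingPPartAt_of_bsdp W p (bsdp_of_classX4M_noMilne hGZK hmod hSk hW hnf hHL hX hr hK hX11)

end NoMilne

end Summit.BirchSwinnertonDyer.Rank1Residual.AdditivePotMult

end
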